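import Mathlib
import Summits.KontsevichZagierPeriods.Zeta5Search.SecondOrderRaise
import Summits.KontsevichZagierPeriods.Zeta5Search.ClassFunctionPFIdentity
import HarnessLib

/-!
# ζ(5) search — the TRANSLATION TERM of the raise lemma vanishes: `corr(T) = 0` for a realised raise `1 :: T`

Cell `pub-zeta5` (HONEST FRAMING: systematic search; no irrationality claim unless certified), typer seat generation 11.
REPORT-gen2-g10 §2.2 (R2): "`v̂[Ψ(·−1)] = v̂[Ψ] + Ψ(−1)` for `deg Ψ < 0`, and `Ψ = (η+1)Φ_T` vanishes at `−1`".  In the tree's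
language: if a residue class `y` (base `y < p`, no odd centre) realises the type `1 :: T` — a ZERO at level `0` followed by `T` — and
has negative class exponent, then the translation term `typeCorr L e` of `typeV_consOne` (= the sum of the principal parts of the
class function `Φ_y` evaluated at the zero `η = 0`) vanishes.  Proof: typer g9's partial-fraction identity `classPF` for `Φ_y` at
`k = 0`, evaluated at `X = 0`, where the numerator vanishes and the denominator does not; the class data of `y` are the type data of
`1 :: T` (`classRho_level₀`, `typeRho_consOne`).  Polynomial algebra over `ℚ`; nothing here bears on irrationality.
-/

noncomputable section

open Finset Polynomial

namespace Summit.KontsevichZagierPeriods.Zeta5Search.SecondOrder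

open Summit.KontsevichZagierPeriods.Zeta5Search.ClusterValuation
open Summit.KontsevichZagierPeriods.Zeta5Search.LevelClass (typeRho typeW typeV typeExp classSet_level level_injective level_mem
  classPoles_level)
open Literature.NumberTheory.Transcendental.BallRivoal (harm)

variable {p : ℕ} [hp : Fact p.Prime]

/-- `ρ^{(0)}_{q,σ} = ρ_{q,σ}`. -/
theorem rhoK_zero (b : ℕ → ℤ) (p q σ : ℕ) : rhoK b p q 0 σ = classRho b p q σ := by
  unfold rhoK classRho
  rw [pow_zero, one_mul]

/-- **`corr(T) = 0` for a realised raise `1 :: T` of negative exponent.**  If the class of `y < p` (levels `0..L+1`, no odd centre)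
has exponents `consOne e` and `E_y < 0`, then `typeCorr L e = 0`. -/
theorem typeCorr_eq_zero_of_consClass (b : ℕ → ℤ) {y L : ℕ} (hy : y < p) (hM : y + (L + 1) * p ≤ (b 0).toNat)
    (hM' : (b 0).toNat < y + (L + 1) * p + p) (e : ℕ → ℤ) (he : ∀ i ≤ L + 1, netExp b (y + i * p) = consOne e i)
    (hc0 : ¬ (¬ (2 : ℤ) ∣ b 0 ∧ CentreIn b p y)) (hneg : classExp b p y < 0) : typeCorr L e = 0 := by
  have hp0 : 0 < p := hp.out.pos
  have hp0' : (p : ℚ) ≠ 0 := Nat.cast_ne_zero.2 hp.out.ne_zero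
  -- the partial-fraction identity at `k = 0`
  have hdeg : degN b p y + 0 < degD b p y := by
    have := classExp_eq_degN_sub_degD b p y; omega
  have hPF := classPF b hp0 0 hdeg
  rw [pow_zero, one_mul] at hPF
  -- evaluate at `X = 0`
  have hev := congrArg (Polynomial.eval 0) hPF
  -- the numerator vanishes at `0` (the base `y` is a zero of the class, at level `0`)
  have hy0 : y ∈ classSet b p y := by simpa using level_mem b hy hM hM' (Nat.zero_le _)
  have hey : netExp b y = 1 := by have := he 0 (Nat.zero_le _); rw [zero_mul, add_zero, consOne, if_pos rfl] at this; exact this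
  have hlvly : lvl p y = 0 := by unfold lvl; rw [Nat.div_eq_of_lt hy]; simp
  have hN0 : (numPhi b p y).eval 0 = 0 := by
    unfold numPhi
    rw [Polynomial.eval_mul, Polynomial.eval_prod]
    refine mul_eq_zero_of_left (prod_eq_zero (mem_filter.2 ⟨hy0, by rw [hey]; norm_num⟩) ?_) _
    rw [hey, hlvly, Polynomial.eval_pow, Polynomial.eval_sub, Polynomial.eval_X, Polynomial.eval_C]; simp
  rw [hN0, Polynomial.eval_finsetSum] at hev
  simp only [Polynomial.eval_finsetSum, Polynomial.eval_mul, Polynomial.eval_C] at hev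
  -- the poles of the class: levels `i + 1` with `e i < 0`
  have hP : classPoles b p y = ((range (L + 1 + 1)).filter fun k => consOne e k < 0).image fun k => y + k * p :=
    classPoles_level b hy hM hM' (consOne e) he
  -- the denominator at `0`
  have hlv : ∀ k, lvl p (y + k * p) = (k : ℚ) := fun k => by unfold lvl; rw [level_div hy]
  set D0 := (denPhi b p y).eval 0 with hD0
  have hD0ne : D0 ≠ 0 := by
    rw [hD0, denPhi, Polynomial.eval_prod]
    refine prod_ne_zero_iff.2 fun q hq => ?_
    rw [hP] at hq
    obtain ⟨k, hk, rfl⟩ := mem_image.1 hq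
    have hk0 : k ≠ 0 := by
      rintro rfl
      have := (mem_filter.1 hk).2
      rw [consOne, if_pos rfl] at this; omega
    rw [Polynomial.eval_pow, Polynomial.eval_sub, Polynomial.eval_X, Polynomial.eval_C, hlv]
    exact pow_ne_zero _ (by rw [zero_sub, neg_ne_zero]; exact_mod_cast hk0)
  -- `eval 0 (pfM y q σ) = D0 · ((−ℓ_q)^σ)⁻¹`
  have hpfM : ∀ q ∈ classPoles b p y, ∀ σ ∈ Icc 1 (-netExp b q).toNat,
      (pfM b p y q σ).eval 0 = D0 * ((0 - lvl p q) ^ σ)⁻¹ := by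
    intro q hq σ hσ
    have hσ' := (mem_Icc.1 hσ).2
    have hlq : lvl p q ≠ 0 := by
      rw [hP] at hq
      obtain ⟨k, hk, rfl⟩ := mem_image.1 hq
      have hk0 : k ≠ 0 := by
        rintro rfl
        have := (mem_filter.1 hk).2
        rw [consOne, if_pos rfl] at this; omega
      rw [hlv]; exact_mod_cast hk0
    have hD : D0 = (denOff b p y q).eval 0 * (0 - lvl p q) ^ (-netExp b q).toNat := by
      rw [hD0, denPhi_eq_denOff_mul b p y hq, Polynomial.eval_mul, Polynomial.eval_pow, Polynomial.eval_sub, Polynomial.eval_X, Polynomial.eval_C]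
    rw [pfM, Polynomial.eval_mul, Polynomial.eval_pow, Polynomial.eval_sub, Polynomial.eval_X, Polynomial.eval_C, hD]
    have hz : (0 - lvl p q) ≠ 0 := by rw [zero_sub, neg_ne_zero]; exact hlq
    rw [mul_assoc, ← pow_sub₀ _ hz hσ']
  have hsum : ∑ q ∈ classPoles b p y, ∑ σ ∈ Icc 1 (-netExp b q).toNat, rhoK b p q 0 σ * (pfM b p y q σ).eval 0 =
      D0 * ∑ q ∈ classPoles b p y, ∑ σ ∈ Icc 1 (-netExp b q).toNat, classRho b p q σ * ((0 - lvl p q) ^ σ)⁻¹ := by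
    rw [mul_sum]
    refine sum_congr rfl fun q hq => ?_
    rw [mul_sum]
    refine sum_congr rfl fun σ hσ => ?_
    rw [rhoK_zero, hpfM q hq σ hσ]; ring
  rw [hsum] at hev
  have hS : ∑ q ∈ classPoles b p y, ∑ σ ∈ Icc 1 (-netExp b q).toNat, classRho b p q σ * ((0 - lvl p q) ^ σ)⁻¹ = 0 := by
    rcases mul_eq_zero.1 hev.symm with h | h
    · exact absurd h hD0ne
    · exact h
  -- reindex over the levels `k = i + 1`
  rw [hP, sum_image (fun a _ c _ h => level_injective hp0 y h)] at hS
  rw [sum_filter, sum_range_succ', show consOne e 0 = 1 by rw [consOne, if_pos rfl], if_neg (by norm_num), add_zero] at hS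
  -- compare termwise with `typeCorr`
  have hT : typeCorr L e = ∑ k ∈ range (L + 1), (if consOne e (k + 1) < 0 then
      ∑ σ ∈ Icc 1 (-netExp b (y + (k + 1) * p)).toNat,
        classRho b p (y + (k + 1) * p) σ * ((0 - lvl p (y + (k + 1) * p)) ^ σ)⁻¹ else 0) := by
    unfold typeCorr
    rw [sum_filter]
    refine sum_congr rfl fun i hi => ?_
    have hiL : i ≤ L := by have := mem_range.1 hi; omega
    have hci : consOne e (i + 1) = e i := by rw [consOne, if_neg (by omega), Nat.add_sub_cancel]
    rw [hci]
    by_cases h0 : e i < 0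
    · rw [if_pos h0, if_pos h0, he (i + 1) (by omega), hci]
      refine sum_congr rfl fun σ hσ => ?_
      have hσ' := mem_Icc.1 hσ
      rw [classRho_level₀ b hy hM hM' (consOne e) he hc0 (by omega : i + 1 ≤ L + 1) σ, typeRho_consOne e i (by omega), hlv]
      have hne : (((i : ℕ) : ℚ) + 1) ≠ 0 := by positivity
      rw [show ((0 : ℚ) - ((i + 1 : ℕ) : ℚ)) = (-1) * ((((i : ℕ) : ℚ)) + 1) by push_cast; ring, mul_pow, mul_inv,
        ← inv_pow (-1 : ℚ), inv_neg_one]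
      field_simp
    · rw [if_neg h0, if_neg h0]
  rw [hT]
  exact hS

end Summit.KontsevichZagierPeriods.Zeta5Search.SecondOrder

end
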